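import Literature.NumberTheory.Transcendental.EllIterRepShuffle
import Literature.NumberTheory.Transcendental.EllIterRepReversal
import Summits.KontsevichZagierPeriods.KontsevichZagierPeriods.Theorems.NormalFormPrinciple.Negative.WindowInvariant

/-!
# Route GenusOneIterated — support item `LemniscaticSectorKernel` (stmt-KontsevichZagierPeriods-8548),
# file 2: the lemniscatic arc

The sector of the item: iterated integrals `I(w) = KZ.ellIterRep γ w` of words `w` in `ω = dx/y`,
`η = x dx/y` along the upper arc `γ` of the real oval of the LEMNISCATIC curve
`E : y² = 4x³ − 4x = 4(x − 1)(x − 0)(x + 1)` from the 2-torsion point `(−1, 0)` to the 2-torsion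
point `(0, 0)` (`e₁ = 1`, `e₂ = 0`, `e₃ = −1`; `γ.lo = −1`, `γ.hi = 0`, upper sheet, increasing `x`).
No definition is introduced: the curve and the arc are ARBITRARY `E : KZ.EllCurve`, `γ : KZ.EllArc E`
subject to the seven equations, bundled as the two hypotheses `hE`, `hγ` below (this is the form in
which a typed version of the item quantifies over them). This file identifies, for such `(E, γ)`:

* the domains `KZ.ellDomain γ n` (`n = 1, 2, 3`; `n = 0` is `KZ.ellDomain_zero`) with the literal ordered simplices
  `{−1 < x₀ < ⋯ < x_{n−1} < 0}` of the route's crux statements (`ellDomain_one/two/three`);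
* the integrands `KZ.ellIntegrand γ w` of the six words entering the cruxes with the literal
  integrands `x₂/(√(4x₀³−4x₀)√(4x₁³−4x₁)√(4x₂³−4x₂))`, … (`ellIntegrand_*`);
* the value `I(ω) = ∫_{(−1,0)} dx/√(4x³ − 4x)` (`= ϖ/2 = 1.3110287771…`, half the real period).

References: D. F. Lawden, *Elliptic Functions and Applications* (1989), §6.12; K.-T. Chen,
*Iterated path integrals* (1977), §1.1; M. Kontsevich, D. Zagier, *Periods* (2001), §1.1.
-/

noncomputable section

open MeasureTheory Set
open Literature.NumberTheory.Transcendental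
open Literature.NumberTheory.Transcendental.KZ

namespace Summit.KontsevichZagierPeriods.GenusOneIterated.LemniscaticSectorKernel

variable {E : EllCurve} {γ : EllArc E} {n : ℕ}

/-! ## The curve `y² = 4x³ − 4x` and the arc -/

/-- On the lemniscatic curve `f(x) = 4(x − 1)x(x + 1) = 4x³ − 4x`. [Lawden 1989, §6.12] -/
theorem f_eq (hE : E.e₁ = 1 ∧ E.e₂ = 0 ∧ E.e₃ = -1) (x : ℝ) : E.f x = 4 * x ^ 3 - 4 * x := by
  rw [EllCurve.f, hE.1, hE.2.1, hE.2.2]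
  ring

/-- The orientation sign of a forward arc is `1`. [folklore] -/
theorem orSign_eq (hγ : γ.lo = -1 ∧ γ.hi = 0 ∧ γ.upper = true ∧ γ.forward = true) : γ.orSign = 1 := by
  simp [EllArc.orSign, hγ.2.2.2]

/-- On the upper sheet of the lemniscatic curve `y(x) = √(4x³ − 4x)`. [Lawden 1989, §6.12] -/
theorem y_eq (hE : E.e₁ = 1 ∧ E.e₂ = 0 ∧ E.e₃ = -1)
    (hγ : γ.lo = -1 ∧ γ.hi = 0 ∧ γ.upper = true ∧ γ.forward = true) (x : ℝ) :
    γ.y x = Real.sqrt (4 * x ^ 3 - 4 * x) := by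
  simp [EllArc.y, EllArc.sheetSign, hγ.2.2.1, f_eq hE]

/-- Words in `ω`, `η` (indeed in any forms `xʲ dx/y`) are adapted to every arc. [folklore] -/
theorem adapted_pow (γ : EllArc E) (j : Fin n → ℕ) : γ.Adapted fun k => EllLetter.pow (j k) :=
  fun _ => trivial

/-! ## The domains: ordered simplices between the 2-torsion abscissae `−1 < ⋯ < 0` -/

/-- `Δ₁(γ) = {−1 < x₀ < 0}`. [folklore] -/
theorem ellDomain_one (hγ : γ.lo = -1 ∧ γ.hi = 0 ∧ γ.upper = true ∧ γ.forward = true) :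
    ellDomain γ 1 = {x | -1 < x 0 ∧ x 0 < 0} := by
  ext x
  rw [mem_ellDomain_iff_of_forward γ hγ.2.2.2, hγ.1, hγ.2.1]
  simp only [Fin.forall_fin_one, mem_setOf_eq]
  constructor
  · rintro ⟨h1, h2, -⟩
    exact ⟨h1, h2⟩
  · rintro ⟨h1, h2⟩
    exact ⟨h1, h2, Subsingleton.strictMono x⟩

/-- `Δ₂(γ) = {−1 < x₀ < x₁ < 0}`. [folklore] -/
theorem ellDomain_two (hγ : γ.lo = -1 ∧ γ.hi = 0 ∧ γ.upper = true ∧ γ.forward = true) :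
    ellDomain γ 2 = {x | -1 < x 0 ∧ x 0 < x 1 ∧ x 1 < 0} := by
  ext x
  rw [mem_ellDomain_iff_of_forward γ hγ.2.2.2, hγ.1, hγ.2.1, Fin.strictMono_iff_lt_succ]
  simp only [Fin.forall_fin_one, Fin.forall_fin_two, mem_setOf_eq, Fin.castSucc_zero, Fin.succ_zero_eq_one]
  constructor
  · rintro ⟨⟨h0, -⟩, ⟨-, h3⟩, h4⟩
    exact ⟨h0, h4, h3⟩
  · rintro ⟨h0, h4, h3⟩
    exact ⟨⟨h0, by linarith⟩, ⟨by linarith, h3⟩, h4⟩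

/-- `Δ₃(γ) = {−1 < x₀ < x₁ < x₂ < 0}`. [folklore] -/
theorem ellDomain_three (hγ : γ.lo = -1 ∧ γ.hi = 0 ∧ γ.upper = true ∧ γ.forward = true) :
    ellDomain γ 3 = {x | -1 < x 0 ∧ x 0 < x 1 ∧ x 1 < x 2 ∧ x 2 < 0} := by
  ext x
  rw [mem_ellDomain_iff_of_forward γ hγ.2.2.2, hγ.1, hγ.2.1, Fin.strictMono_iff_lt_succ]
  simp only [Fin.forall_fin_succ, IsEmpty.forall_iff, and_true, mem_setOf_eq, Fin.castSucc_zero,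
    Fin.succ_zero_eq_one, Fin.castSucc_one, Fin.succ_one_eq_two]
  constructor
  · rintro ⟨⟨h0, -, -⟩, ⟨-, -, h5⟩, h6, h7⟩
    exact ⟨h0, h6, h7, h5⟩
  · rintro ⟨h0, h6, h7, h5⟩
    exact ⟨⟨h0, by linarith, by linarith⟩, ⟨by linarith, by linarith, h5⟩, h6, h7⟩

/-! ## The integrands of the words entering the cruxes -/

/-- `I(ω)`: integrand `1/√(4x₀³ − 4x₀)`. [Lawden 1989, §6.12] -/
theorem ellIntegrand_ω (hE : E.e₁ = 1 ∧ E.e₂ = 0 ∧ E.e₃ = -1)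
    (hγ : γ.lo = -1 ∧ γ.hi = 0 ∧ γ.upper = true ∧ γ.forward = true) (x : Fin 1 → ℝ) :
    ellIntegrand γ ![EllLetter.ω] x = 1 / Real.sqrt (4 * x 0 ^ 3 - 4 * x 0) := by
  simp [ellIntegrand, orSign_eq hγ, y_eq hE hγ]

/-- `I(η)`: integrand `x₀/√(4x₀³ − 4x₀)`. [Lawden 1989, §6.13] -/
theorem ellIntegrand_η (hE : E.e₁ = 1 ∧ E.e₂ = 0 ∧ E.e₃ = -1)
    (hγ : γ.lo = -1 ∧ γ.hi = 0 ∧ γ.upper = true ∧ γ.forward = true) (x : Fin 1 → ℝ) :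
    ellIntegrand γ ![EllLetter.η] x = x 0 / Real.sqrt (4 * x 0 ^ 3 - 4 * x 0) := by
  simp [ellIntegrand, orSign_eq hγ, y_eq hE hγ]

/-- `I(ωη)`: integrand `x₁/(y₀ y₁)`. [Chen 1977, §1.1] -/
theorem ellIntegrand_ωη (hE : E.e₁ = 1 ∧ E.e₂ = 0 ∧ E.e₃ = -1)
    (hγ : γ.lo = -1 ∧ γ.hi = 0 ∧ γ.upper = true ∧ γ.forward = true) (x : Fin 2 → ℝ) :
    ellIntegrand γ ![EllLetter.ω, EllLetter.η] x =
      x 1 / (Real.sqrt (4 * x 0 ^ 3 - 4 * x 0) * Real.sqrt (4 * x 1 ^ 3 - 4 * x 1)) := by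
  simp only [ellIntegrand, orSign_eq hγ, one_pow, one_mul, Fin.prod_univ_two, Matrix.cons_val_zero,
    Matrix.cons_val_one, EllLetter.density_pow, y_eq hE hγ, pow_zero, pow_one]
  ring

/-- `I(ηω)`: integrand `x₀/(y₀ y₁)`. [Chen 1977, §1.1] -/
theorem ellIntegrand_ηω (hE : E.e₁ = 1 ∧ E.e₂ = 0 ∧ E.e₃ = -1)
    (hγ : γ.lo = -1 ∧ γ.hi = 0 ∧ γ.upper = true ∧ γ.forward = true) (x : Fin 2 → ℝ) :
    ellIntegrand γ ![EllLetter.η, EllLetter.ω] x =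
      x 0 / (Real.sqrt (4 * x 0 ^ 3 - 4 * x 0) * Real.sqrt (4 * x 1 ^ 3 - 4 * x 1)) := by
  simp only [ellIntegrand, orSign_eq hγ, one_pow, one_mul, Fin.prod_univ_two, Matrix.cons_val_zero,
    Matrix.cons_val_one, EllLetter.density_pow, y_eq hE hγ, pow_zero, pow_one]
  ring

/-- `I(ωωη)`: integrand `x₂/(y₀ y₁ y₂)`. [Chen 1977, §1.1] -/
theorem ellIntegrand_ωωη (hE : E.e₁ = 1 ∧ E.e₂ = 0 ∧ E.e₃ = -1)
    (hγ : γ.lo = -1 ∧ γ.hi = 0 ∧ γ.upper = true ∧ γ.forward = true) (x : Fin 3 → ℝ) :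
    ellIntegrand γ ![EllLetter.ω, EllLetter.ω, EllLetter.η] x =
      x 2 / (Real.sqrt (4 * x 0 ^ 3 - 4 * x 0) * Real.sqrt (4 * x 1 ^ 3 - 4 * x 1) *
        Real.sqrt (4 * x 2 ^ 3 - 4 * x 2)) := by
  simp only [ellIntegrand, orSign_eq hγ, one_pow, one_mul, Fin.prod_univ_three, Matrix.cons_val_zero,
    Matrix.cons_val_one, Matrix.cons_val_two, Matrix.head_cons, Matrix.tail_cons, EllLetter.density_pow,
    y_eq hE hγ, pow_zero, pow_one]
  ring

/-- `I(ωηη)`: integrand `x₁ x₂/(y₀ y₁ y₂)`. [Chen 1977, §1.1] -/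
theorem ellIntegrand_ωηη (hE : E.e₁ = 1 ∧ E.e₂ = 0 ∧ E.e₃ = -1)
    (hγ : γ.lo = -1 ∧ γ.hi = 0 ∧ γ.upper = true ∧ γ.forward = true) (x : Fin 3 → ℝ) :
    ellIntegrand γ ![EllLetter.ω, EllLetter.η, EllLetter.η] x =
      x 1 * x 2 / (Real.sqrt (4 * x 0 ^ 3 - 4 * x 0) * Real.sqrt (4 * x 1 ^ 3 - 4 * x 1) *
        Real.sqrt (4 * x 2 ^ 3 - 4 * x 2)) := by
  simp only [ellIntegrand, orSign_eq hγ, one_pow, one_mul, Fin.prod_univ_three, Matrix.cons_val_zero,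
    Matrix.cons_val_one, Matrix.cons_val_two, Matrix.head_cons, Matrix.tail_cons, EllLetter.density_pow,
    y_eq hE hγ, pow_zero, pow_one]
  ring

/-! ## The value `I(ω) = ∫_{(−1,0)} dx/√(4x³ − 4x)` -/

/-- **`I(ω) = ∫_{(−1,0)} dx/√(4x³ − 4x)`** (half the real period `ϖ = 2.62205…` of the
lemniscatic curve): the value of the one-letter representation as a real integral.
[Lawden 1989, §6.12 (6.12.25)] -/
theorem ellIterRep_ω_value (hE : E.e₁ = 1 ∧ E.e₂ = 0 ∧ E.e₃ = -1)
    (hγ : γ.lo = -1 ∧ γ.hi = 0 ∧ γ.upper = true ∧ γ.forward = true)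
    (hw : γ.Adapted ![EllLetter.ω]) :
    (ellIterRep γ ![EllLetter.ω] hw).value =
      ∫ x in Ioo (-1:ℝ) 0, 1 / Real.sqrt (4 * x ^ 3 - 4 * x) := by
  rw [ellIterRep_value, ellDomain_one hγ]
  have hdom : {x : Fin 1 → ℝ | -1 < x 0 ∧ x 0 < 0} = {x | x 0 ∈ Ioo (-1:ℝ) 0} := rfl
  rw [hdom, Summit.KontsevichZagierPeriods.HurwitzMicroSectors.NormalFormPrinciple.Negative.setIntegral_fin_one
    (ellIntegrand γ ![EllLetter.ω]) (Ioo (-1:ℝ) 0)]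
  refine setIntegral_congr_fun measurableSet_Ioo fun t _ => ?_
  rw [ellIntegrand_ω hE hγ]

/-- **`I(η)`** as a real integral: `∫_{(−1,0)} x dx/√(4x³ − 4x)` (`= −η₁/2 = −0.59907…`).
[Lawden 1989, §6.13] -/
theorem ellIterRep_η_value (hE : E.e₁ = 1 ∧ E.e₂ = 0 ∧ E.e₃ = -1)
    (hγ : γ.lo = -1 ∧ γ.hi = 0 ∧ γ.upper = true ∧ γ.forward = true)
    (hw : γ.Adapted ![EllLetter.η]) :
    (ellIterRep γ ![EllLetter.η] hw).value =
      ∫ x in Ioo (-1:ℝ) 0, x / Real.sqrt (4 * x ^ 3 - 4 * x) := by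
  rw [ellIterRep_value, ellDomain_one hγ]
  have hdom : {x : Fin 1 → ℝ | -1 < x 0 ∧ x 0 < 0} = {x | x 0 ∈ Ioo (-1:ℝ) 0} := rfl
  rw [hdom, Summit.KontsevichZagierPeriods.HurwitzMicroSectors.NormalFormPrinciple.Negative.setIntegral_fin_one
    (ellIntegrand γ ![EllLetter.η]) (Ioo (-1:ℝ) 0)]
  refine setIntegral_congr_fun measurableSet_Ioo fun t _ => ?_
  rw [ellIntegrand_η hE hγ]

/-! ## List words versus vector words -/

/-- `List.ofFn ![l₀] = [l₀]`. [folklore] -/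
theorem ofFn_vec1 (l₀ : EllLetter) : List.ofFn ![l₀] = [l₀] := by simp [List.ofFn_succ]

/-- `List.ofFn ![l₀, l₁] = [l₀, l₁]`. [folklore] -/
theorem ofFn_vec2 (l₀ l₁ : EllLetter) : List.ofFn ![l₀, l₁] = [l₀, l₁] := by simp [List.ofFn_succ]

/-- `List.ofFn ![l₀, l₁, l₂] = [l₀, l₁, l₂]`. [folklore] -/
theorem ofFn_vec3 (l₀ l₁ l₂ : EllLetter) : List.ofFn ![l₀, l₁, l₂] = [l₀, l₁, l₂] := by
  simp [List.ofFn_succ]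

/-- A list of letters `x^j dx/y` is adapted to every arc. [folklore] -/
theorem adapted_get_of_forall_pow (γ : EllArc E) (l : List EllLetter) (h : ∀ a ∈ l, ∃ j, a = EllLetter.pow j) :
    γ.Adapted l.get := fun k => by
  obtain ⟨j, hj⟩ := h _ (List.get_mem l k)
  rw [hj]
  trivial

/-- `[l₀]` with a letter `x^j dx/y` is adapted. [folklore] -/
theorem adapted_list1 (γ : EllArc E) (j₀ : ℕ) : γ.Adapted [EllLetter.pow j₀].get :=
  adapted_get_of_forall_pow γ _ (by simp)

/-- `[l₀, l₁]` with letters `x^j dx/y` is adapted. [folklore] -/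
theorem adapted_list2 (γ : EllArc E) (j₀ j₁ : ℕ) : γ.Adapted [EllLetter.pow j₀, EllLetter.pow j₁].get :=
  adapted_get_of_forall_pow γ _ (by simp)

/-- The class of a one-letter list word is the class of the vector word. [folklore] -/
theorem ellClass_vec1 (γ : EllArc E) (l₀ : EllLetter) (hw : γ.Adapted ![l₀]) :
    ellClass γ [l₀] = of (ellIterRep γ ![l₀] hw) := by
  rw [← ofFn_vec1]; exact ellClass_ofFn γ _ hw

/-- The class of a two-letter list word is the class of the vector word. [folklore] -/
theorem ellClass_vec2 (γ : EllArc E) (l₀ l₁ : EllLetter) (hw : γ.Adapted ![l₀, l₁]) :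
    ellClass γ [l₀, l₁] = of (ellIterRep γ ![l₀, l₁] hw) := by
  rw [← ofFn_vec2]; exact ellClass_ofFn γ _ hw

/-- The class of a three-letter list word is the class of the vector word. [folklore] -/
theorem ellClass_vec3 (γ : EllArc E) (l₀ l₁ l₂ : EllLetter) (hw : γ.Adapted ![l₀, l₁, l₂]) :
    ellClass γ [l₀, l₁, l₂] = of (ellIterRep γ ![l₀, l₁, l₂] hw) := by
  rw [← ofFn_vec3]; exact ellClass_ofFn γ _ hw

end Summit.KontsevichZagierPeriods.GenusOneIterated.LemniscaticSectorKernel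

end
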